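import Summits.Ventures.LatticeQCDFlow.Scaling.SimulatedTemperingFlowSampler
import Summits.Ventures.LatticeQCDFlow.Scaling.SimulatedTemperingModeTorpid

/-!
HONEST FRAMING: exact (Metropolis-corrected) sampling algorithms for lattice gauge theory; figures
of merit are autocorrelation/cost numbers at stated couplings and volumes; no continuum-physics
claim.

# SimulatedTemperingFlowTorpid — SECTOR-PRESERVING TRANSPORT MAPS DO NOT CREATE TUNNELLING: FOR BIJECTIONS `φ_j` WITH
# `φ_j(A) = A` THE TEMPERING SAMPLER WITH TRANSPORT MOVES HAS THE SAME EXIT FLOW FROM "SECTOR `A` AT ANY LEVEL" AS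
# THE PLAIN ONE, `((1−t)/(K+1))·Σ_k Q_k(A,Aᶜ)`, HENCE `Gap ≤ (1−t)(K+1)Σ_kQ_k(A,Aᶜ)/(m_A((K+1) − m_A))`
# (lean-2 GEN-19, ours)

Venture-side (OURS).  Cell `lqcd-flow` (pub-lqcd), unit `pub-lqcd-lean-2-g19`, 2026-08-25.  The ceiling of
`Scaling/SimulatedTemperingModeTorpid` (GEN-17: tempering IMPORTS tunnelling, it does not create it) for the
sampler with transport maps of `Scaling/SimulatedTemperingFlowSampler` (`stFlowSampler t μ M φ`: moving up from
level `j` the configuration is mapped by `φ_j`, moving down by `φ_j⁻¹`, Metropolis-corrected).  The one hypothesis on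
the maps: they PRESERVE THE SECTOR, `φ_j u ∈ A ↔ u ∈ A`.  Then a transport level move never carries a configuration
out of `A`, the stationary exit flow from `T = {(k,x) : x ∈ A}` is exactly the ladder average of the within-level
exit flows, and the test function `f_T` caps the spectral gap as before — whatever the maps, even perfect transports
`φ_j♯μ_j = μ_{j+1}` (acceptance one at every rung).

## What is proved

* `stFlowLevel_eq_zero_of_sector` — for `p.2 ∈ A`, `q.2 ∉ A` and sector-preserving maps, `FL(p,q) = 0`;
  **`stFlow_edgeMeasure_product`** — `Q_P(T,Tᶜ) = ((1−t)/(K+1))·Σ_k Q_k(A,Aᶜ)` for `P = stFlowSampler t μ M φ`;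
  **`stFlow_spectralGap_le_sector`** — `Gap(P) ≤ (1−t)(K+1)·Σ_kQ_k(A,Aᶜ)/(m_A((K+1) − m_A))`, `m_A = Σ_kμ_k(A)`,
  for every `A` with `0 < m_A < K+1` (`0 ≤ t ≤ 1`); **`stFlow_spectralGap_le_of_frozen`** — if no level's own
  update leaves the sector (`Q_k(A,Aᶜ) = 0` for all `k`), the sampler with transport maps is NOT EVEN ERGODIC in
  rate: `Gap ≤ 0`.

Reading (no numerics implied): deterministic layers between neighbouring levels that map each topological sector
to itself leave the sector content to the stochastic within-level updates; the ladder only redistributes their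
crossings.  NOT CLAIMED: maps that move mass between sectors (they tunnel by construction); continuous spaces;
anything measured.  Literature grade (cell rule): NEW TYPING of a known tension; nothing cited as a fact; no new bib
keys.
-/

noncomputable section

open Finset Function
open Literature.Probability.MarkovChains

namespace Summit.Ventures.LatticeQCDFlow.Scaling

variable {S : Type*} [Fintype S] [DecidableEq S] {K : ℕ} {μ : Fin (K + 1) → S → ℝ}
  {M : Fin (K + 1) → Matrix S S ℝ} {t : ℝ} {φ : Fin K → Equiv.Perm S}

/-- **A sector-preserving transport move never leaves the sector:** for `p.2 ∈ A`, `q.2 ∉ A`, `FL(p,q) = 0`. [ours] -/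
theorem stFlowLevel_eq_zero_of_sector (hμ : ∀ k x, 0 < μ k x) {A : Finset S} (hφA : ∀ j u, φ j u ∈ A ↔ u ∈ A)
    {p q : Fin (K + 1) × S} (hp : p.2 ∈ A) (hq : q.2 ∉ A) : stFlowLevel μ φ p q = 0 := by
  have hqp : q ≠ p := fun e => hq (e ▸ hp)
  refine stFlowLevel_eq_zero_of_not_image hμ hqp (fun j _ e => hq ?_) (fun j _ e => hq ?_)
  · rw [e]; exact (hφA j p.2).mpr hp
  · rw [e]
    show (φ j).symm p.2 ∈ A
    rw [← hφA j ((φ j).symm p.2), Equiv.apply_symm_apply]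
    exact hp

/-- **The exit flow from `T = univ ×ˢ A` under the sampler with sector-preserving transport maps is the ladder average
of the within-level exit flows:** `Q_P(T,Tᶜ) = ((1−t)/(K+1))·Σ_k Q_k(A,Aᶜ)`. [ours] -/
theorem stFlow_edgeMeasure_product (hμ : ∀ k x, 0 < μ k x) {A : Finset S} (hφA : ∀ j u, φ j u ∈ A ↔ u ∈ A) :
    edgeMeasure (stFinLaw μ) (stFlowSampler t μ M φ) ((univ : Finset (Fin (K + 1))) ×ˢ A)
        (((univ : Finset (Fin (K + 1))) ×ˢ A)ᶜ)
      = (1 - t) / (K + 1) * ∑ k, edgeMeasure (μ k) (M k) A Aᶜ := by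
  rw [compl_univ_product]
  unfold edgeMeasure
  rw [Finset.sum_product, Finset.mul_sum]
  refine sum_congr rfl fun k _ => ?_
  rw [Finset.mul_sum]
  refine sum_congr rfl fun x hx => ?_
  rw [Finset.sum_product,
    Finset.sum_eq_single k (fun l _ hlk => ?_) (fun h => absurd (mem_univ k) h)]
  · rw [Finset.mul_sum]
    refine sum_congr rfl fun y hy => ?_
    have hy' : ((k, y) : Fin (K + 1) × S).2 ∉ A := by rw [Finset.mem_compl] at hy; exact hy
    rw [stFlowSampler_apply, stFlowLevel_eq_zero_of_sector hμ hφA (p := (k, x)) hx hy', mul_zero, zero_add,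
      stFinWithin_apply, if_pos rfl]
    unfold stFinLaw
    ring
  · refine Finset.sum_eq_zero fun y hy => ?_
    have hy' : ((l, y) : Fin (K + 1) × S).2 ∉ A := by rw [Finset.mem_compl] at hy; exact hy
    have hl : ¬ ((l, y) : Fin (K + 1) × S).1 = ((k, x) : Fin (K + 1) × S).1 := hlk
    rw [stFlowSampler_apply, stFlowLevel_eq_zero_of_sector hμ hφA (p := (k, x)) hx hy', mul_zero, zero_add,
      stFinWithin_apply, if_neg hl, mul_zero, mul_zero]

/-- **THE GAP CEILING WITH SECTOR-PRESERVING TRANSPORT MAPS:**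
`Gap(stFlowSampler t μ M φ) ≤ (1−t)(K+1)·Σ_k Q_k(A,Aᶜ)/(m_A((K+1) − m_A))` for every set of configurations with
`0 < m_A < K+1` (`0 ≤ t ≤ 1`) — the same as without maps. [ours] -/
theorem stFlow_spectralGap_le_sector (hμ : ∀ k x, 0 < μ k x) (hμ1 : ∀ k, ∑ x, μ k x = 1)
    (hM : ∀ k, IsRowStochastic (M k)) (hMrev : ∀ k, DetailedBalance (μ k) (M k)) (ht0 : 0 ≤ t) (ht1 : t ≤ 1)
    {A : Finset S} (hφA : ∀ j u, φ j u ∈ A ↔ u ∈ A)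
    (hA0 : 0 < ∑ k, ∑ x ∈ A, μ k x) (hA1 : ∑ k, ∑ x ∈ A, μ k x < K + 1) :
    spectralGap (stFinLaw μ) (stFlowSampler t μ M φ)
      ≤ (1 - t) * (K + 1) * (∑ k, edgeMeasure (μ k) (M k) A Aᶜ)
          / ((∑ k, ∑ x ∈ A, μ k x) * ((K + 1) - ∑ k, ∑ x ∈ A, μ k x)) := by
  haveI := stFin_nontrivial_of_mass hμ1 hA0 hA1
  set T := (univ : Finset (Fin (K + 1))) ×ˢ A with hT
  have hP := stFlowSampler_isRowStochastic (M := M) (φ := φ) hμ hM ht0 ht1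
  have hDB := stFlowSampler_detailedBalance (t := t) (M := M) (φ := φ) hμ hMrev
  have hst : IsStationary (stFinLaw μ) (stFlowSampler t μ M φ) := hDB.isStationary hP.2
  have hπ1 := sum_stFinLaw (K := K) hμ1
  have hK : (0 : ℝ) < K + 1 := by positivity
  have hmT : ∑ p ∈ T, stFinLaw μ p = (∑ k, ∑ x ∈ A, μ k x) / (K + 1) := stFin_mass_product A
  have hmTc : ∑ p ∈ Tᶜ, stFinLaw μ p = ((K + 1) - ∑ k, ∑ x ∈ A, μ k x) / (K + 1) := by
    have h := sum_add_sum_compl T (stFinLaw μ)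
    rw [hπ1, hmT] at h
    field_simp at h
    rw [eq_div_iff hK.ne']
    linarith
  have hVar : lawVariance (stFinLaw μ) (bottleneckTestFun (stFinLaw μ) T)
      = (∑ k, ∑ x ∈ A, μ k x) / (K + 1) * (((K + 1) - ∑ k, ∑ x ∈ A, μ k x) / (K + 1)) := by
    rw [lawVariance_bottleneckTestFun hπ1, hmT, hmTc]
  have hVpos : 0 < lawVariance (stFinLaw μ) (bottleneckTestFun (stFinLaw μ) T) := by
    rw [hVar]; exact mul_pos (div_pos hA0 hK) (div_pos (by linarith) hK)
  have hE : dirichletForm (stFinLaw μ) (stFlowSampler t μ M φ) (bottleneckTestFun (stFinLaw μ) T)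
      = (1 - t) / (K + 1) * ∑ k, edgeMeasure (μ k) (M k) A Aᶜ := by
    rw [dirichletForm_bottleneckTestFun hP hst hπ1, hT, stFlow_edgeMeasure_product hμ hφA]
  rw [LevinPeres2017_lemma_13_7 (stFinLaw_pos hμ) hπ1 hP hDB]
  refine (spectralGapR_le_dirichletForm_div_lawVariance (fun p => (stFinLaw_pos hμ p).le) hπ1 hP.1 hVpos).trans
    (le_of_eq ?_)
  rw [hE, hVar]
  field_simp

/-- **IF NO LEVEL'S OWN UPDATE LEAVES THE SECTOR, TRANSPORT MAPS THAT PRESERVE IT GIVE NO RATE AT ALL:**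
`Q_k(A,Aᶜ) = 0` for every `k` ⇒ `Gap(stFlowSampler t μ M φ) ≤ 0`. [ours] -/
theorem stFlow_spectralGap_le_of_frozen (hμ : ∀ k x, 0 < μ k x) (hμ1 : ∀ k, ∑ x, μ k x = 1)
    (hM : ∀ k, IsRowStochastic (M k)) (hMrev : ∀ k, DetailedBalance (μ k) (M k)) (ht0 : 0 ≤ t) (ht1 : t ≤ 1)
    {A : Finset S} (hφA : ∀ j u, φ j u ∈ A ↔ u ∈ A)
    (hA0 : 0 < ∑ k, ∑ x ∈ A, μ k x) (hA1 : ∑ k, ∑ x ∈ A, μ k x < K + 1)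
    (hfrozen : ∀ k, edgeMeasure (μ k) (M k) A Aᶜ = 0) :
    spectralGap (stFinLaw μ) (stFlowSampler t μ M φ) ≤ 0 := by
  have h := stFlow_spectralGap_le_sector (t := t) (M := M) hμ hμ1 hM hMrev ht0 ht1 hφA hA0 hA1
  simp_rw [hfrozen, Finset.sum_const_zero, mul_zero, zero_div] at h
  exact h

end Summit.Ventures.LatticeQCDFlow.Scaling

end
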